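import Literature.NumberTheory.Transcendental.GaGmZariski
import Literature.RingTheory.HilbertSamuel.FilteredHilbertFunction
import Mathlib.Analysis.SpecificLimits.Basic
import Mathlib.Data.Nat.Choose.Sum
import Mathlib.Algebra.Order.BigOperators.Group.Finset
import Mathlib.LinearAlgebra.FiniteDimensional.Lemmas
import HarnessLib

/-!
# Degrees (multiplicities) of subvarieties of `𝔾ₐ × 𝔾ₘⁿ` for box degrees, and the Bézout inequality

Topic `Literature/NumberTheory/Transcendental`. The degree theory behind the multiplicity-free
case of Philippon's zero estimate on `G = 𝔾ₐ × 𝔾ₘⁿ` (`Philippon1986_GaGm_P1n`;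
Nesterenko–Philippon (eds.), LNM 1752, Ch. 11 (D. Roy), §2.2 and Prop. 2.2), built on the Zariski
toolkit `GaGmZariski.lean` and on the Hilbert-function sandwich
`Literature.RingTheory.HilbertSamuel.FilteredHilbert.hilbert_sandwich`. Everything is PROVED.

Instead of the multihomogeneous Hilbert–Samuel theory of Philippon 1986 §3 we use the box
filtration `Box(t) = {deg_X ≤ tD₀, deg_{Y_h} ≤ tD₁}` of `ℂ[X, Y]` (= the standard grading of the
homogeneous coordinate ring of `(ℙ¹)ⁿ⁺¹` in its Segre–Veronese embedding by `𝒪(D₀, D₁, …, D₁)`;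
`GaGm.Box_one_pow`), for which box polynomials are the linear forms and the constant
`(n+1)! D₀ D₁ⁿ` of Diaz's zero lemma is literally the degree of the ambient variety.

* `GaGm.hilbI D₀ D₁ N t = dim Box(t) - dim (Box(t) ∩ N)` and `GaGm.hilb D₀ D₁ X t` (`N = 𝔍(X)`),
  monotone in `t`, antitone in `N`; the basic identities of LNM 1752 Ch. 11 §2.2 in this
  setting: the **section inequality** `H_{𝔭+(ℓ)}(t) + H_𝔭(t-1) ≤ H_𝔭(t)` (`hilbI_sup_span_add_le`,
  from `dim(ℓ·Box(t-1) + Box(t)∩𝔭) = dim Box(t-1) + dim(Box(t)∩𝔭) - dim(Box(t-1)∩𝔭)` for a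
  prime `𝔭 ∌ ℓ`), the **additivity inequality** `H_N(t) + H_𝔮(t-δ) ≤ H_{N ∩ 𝔮}(t)` for
  `a ∈ Box(δ) ∩ N \ 𝔮` (`hilbI_add_le_hilbI_inf`) and its iteration over pairwise incomparable
  primes (`exists_sum_hilbI_le_hilbI_inf`), telescoping (`sum_hilbI_le`).
* `hilb_eq_finrank_pow`: `H_X(t) = dim_ℂ W^t` for `W` the image of `Box(1)` in `ℂ[X,Y] ⧸ 𝔍(X)`;
  hence the **sandwich** `ρ·binom(t-a+m, m) ≤ H_C(t) ≤ ρ·binom(t+γ+m, m)`, `m = dim C`, `ρ ≥ 1`,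
  for irreducible closed `C` (`IsIrred.exists_sandwich`).
* The **multiplicity** `GaGm.mult D₀ D₁ C ∈ ℕ` (`HasMult`, unique by the limit
  `m!·H_C(t)/t^m → ρ`, `HasMult.tendsto`; `≥ 1` for irreducible `C`): the "`𝓗(C; D)`" of LNM 1752
  Ch. 11 (85); `mult_univ : 𝓗(G) = (n+1)! D₀ D₁ⁿ` (from `H_G(t) = (tD₀+1)(tD₁+1)ⁿ`);
  translation invariance (`hilb_smul`, `mult_smul`).
* **Bézout for a hypersurface section** (`sum_mult_section_le`): for irreducible `C` and
  `ℓ ∈ Box(1) \ 𝔍(C)`, `∑_{C' component of C ∩ Z(ℓ)} 𝓗(C') ≤ 𝓗(C)` (all `C'` have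
  `dim C' = dim C - 1` by `GaGm.dimG_add_one_of_mem_minimalPrimes_section`; comparison of leading
  coefficients through the real limits of `Asymp`).
* **Bézout inequality in `G(ℂ)`** (`sum_mult_le_of_subset_Box`): for `F ⊆ Box(1)` with a common
  zero, `∑_{C top-dimensional component of Z(F)} 𝓗(C) ≤ (n+1)! D₀ D₁ⁿ` — LNM 1752 Ch. 11 Prop. 2.2
  in the form needed at `T = 0` (induction on `dim C - dim (C ∩ Z(F))` over irreducible `C`, one
  hypersurface section at a time; no Cohen–Macaulay / unmixedness input is needed for this
  set-theoretic top-dimensional version).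

Deliberately NOT here: multiplicities of non-reduced ideals (lengths), the projective closure,
mixed / lower-dimensional components, anything specific to subgroups (see the sequel files).

## References

* Yu. V. Nesterenko, P. Philippon (eds.), *Introduction to Algebraic Independence Theory*,
  LNM 1752 (2001), Ch. 11 (D. Roy), §2.2 (85) and (i)–(iii), Prop. 2.2 (p. 202).
  [NesterenkoPhilippon2001]
* P. Philippon, *Lemmes de zéros dans les groupes algébriques commutatifs*, Bull. Soc. Math.
  France 114 (1986), 355–383, §3, Prop. 3.3. [Philippon1986]
-/

noncomputable section

section
open Filter Topology

namespace Literature.NumberTheory.Transcendental.GaGm.Asymp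

/-- `((t + a)/t)^m → 1` as `t → ∞` (`a` real). [folklore] -/
theorem tendsto_add_pow_div_pow (a : ℝ) (m : ℕ) :
    Tendsto (fun t : ℕ => ((t : ℝ) + a) ^ m / (t : ℝ) ^ m) atTop (𝓝 1) := by
  have h1 : Tendsto (fun t : ℕ => (1 + a / (t : ℝ)) ^ m) atTop (𝓝 1) := by
    have h := (tendsto_const_div_atTop_nhds_zero_nat a).const_add 1
    simpa using h.pow m
  refine h1.congr' ?_
  filter_upwards [eventually_gt_atTop 0] with t ht
  have ht' : (t : ℝ) ≠ 0 := by exact_mod_cast ht.ne'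
  rw [← div_pow, add_div, div_self ht']

/-- **`m!·binom(t + c - c', m) / t^m → 1`** as `t → ∞`. [folklore] -/
theorem tendsto_factorial_mul_choose_div_pow (c c' m : ℕ) :
    Tendsto (fun t : ℕ => ((m.factorial * (t + c - c').choose m : ℕ) : ℝ) / (t : ℝ) ^ m) atTop (𝓝 1) := by
  -- squeeze between `((t + c - c' + 1 - m)/t)^m` and `((t + c - c')/t)^m`
  have hlow := tendsto_add_pow_div_pow ((c : ℝ) - c' + 1 - m) m
  have hhigh := tendsto_add_pow_div_pow ((c : ℝ) - c') m
  refine tendsto_of_tendsto_of_tendsto_of_le_of_le' hlow hhigh ?_ ?_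
  · filter_upwards [eventually_ge_atTop (c' + m + 1)] with t ht
    have ht0 : (0 : ℝ) < (t : ℝ) := by exact_mod_cast (show 0 < t by omega)
    have hpos : (0 : ℝ) < (t : ℝ) ^ m := by positivity
    rw [div_le_div_iff_of_pos_right hpos, ← Nat.descFactorial_eq_factorial_mul_choose]
    have h := Nat.pow_sub_le_descFactorial (t + c - c') m
    have hcast : ((t : ℝ) + (↑c - ↑c' + 1 - ↑m)) = ((t + c - c' + 1 - m : ℕ) : ℝ) := by
      rw [Nat.cast_sub (by omega), Nat.cast_add, Nat.cast_sub (by omega)]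
      push_cast; ring
    rw [hcast]
    exact_mod_cast h
  · filter_upwards [eventually_ge_atTop (c' + m + 1)] with t ht
    have ht0 : (0 : ℝ) < (t : ℝ) := by exact_mod_cast (show 0 < t by omega)
    have hpos : (0 : ℝ) < (t : ℝ) ^ m := by positivity
    rw [div_le_div_iff_of_pos_right hpos, ← Nat.descFactorial_eq_factorial_mul_choose]
    have h := Nat.descFactorial_le_pow (t + c - c') m
    have hcast : ((t : ℝ) + (↑c - ↑c')) = ((t + c - c' : ℕ) : ℝ) := by
      rw [Nat.cast_sub (by omega)]; push_cast; ring
    rw [hcast]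
    exact_mod_cast h

/-- **Comparison of leading coefficients.** If
`∑ᵢ ρᵢ · binom(t - cᵢ + m, m) ≤ ρ · binom(t + γ + m, m)` for all large `t`, then `∑ᵢ ρᵢ ≤ ρ`.
[folklore] -/
theorem sum_le_of_choose_ineq {ι : Type*} (s : Finset ι) (ρ : ℕ) (ρ' : ι → ℕ) (c : ι → ℕ)
    (γ m t₀ : ℕ)
    (h : ∀ t, t₀ ≤ t → ∑ i ∈ s, ρ' i * (t - c i + m).choose m ≤ ρ * (t + γ + m).choose m) :
    ∑ i ∈ s, ρ' i ≤ ρ := by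
  -- normalised sequences
  set L : ℕ → ℝ := fun t => ∑ i ∈ s, (ρ' i : ℝ) *
    (((m.factorial * (t + m - c i).choose m : ℕ) : ℝ) / (t : ℝ) ^ m) with hL
  set R : ℕ → ℝ := fun t => (ρ : ℝ) * (((m.factorial * (t + (γ + m) - 0).choose m : ℕ) : ℝ) / (t : ℝ) ^ m)
    with hR
  have hLlim : Tendsto L atTop (𝓝 (∑ i ∈ s, (ρ' i : ℝ))) := by
    have : (∑ i ∈ s, (ρ' i : ℝ)) = ∑ i ∈ s, (ρ' i : ℝ) * 1 := by simp
    rw [this]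
    exact tendsto_finsetSum _ fun i _ =>
      (tendsto_factorial_mul_choose_div_pow m (c i) m).const_mul _
  have hRlim : Tendsto R atTop (𝓝 (ρ : ℝ)) := by
    have h := (tendsto_factorial_mul_choose_div_pow (γ + m) 0 m).const_mul (ρ : ℝ)
    rw [mul_one] at h
    exact h
  have hle : ∀ᶠ t in atTop, L t ≤ R t := by
    filter_upwards [eventually_ge_atTop (t₀ + 1 + s.sup c)] with t ht
    have hpos : (0 : ℝ) < (t : ℝ) ^ m := by
      have : (0 : ℝ) < t := by exact_mod_cast (show 0 < t by omega)
      positivity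
    have h' := h t (by omega)
    have hci : ∀ i ∈ s, c i ≤ t := fun i hi => (Finset.le_sup hi).trans (by omega)
    -- multiply the integer inequality by `m!/t^m`
    have e1 : L t = ((m.factorial : ℝ) / (t : ℝ) ^ m) * ((∑ i ∈ s, ρ' i * (t - c i + m).choose m : ℕ) : ℝ) := by
      rw [hL]
      simp only []
      push_cast
      rw [Finset.mul_sum]
      refine Finset.sum_congr rfl fun i hi => ?_
      rw [show t + m - c i = t - c i + m by have := hci i hi; omega]
      ring
    have e2 : R t = ((m.factorial : ℝ) / (t : ℝ) ^ m) * ((ρ * (t + γ + m).choose m : ℕ) : ℝ) := by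
      rw [hR]
      simp only [Nat.sub_zero]
      push_cast
      rw [show t + (γ + m) = t + γ + m by omega]
      ring
    rw [e1, e2]
    exact mul_le_mul_of_nonneg_left (by exact_mod_cast h') (by positivity)
  have := le_of_tendsto_of_tendsto hLlim hRlim hle
  exact_mod_cast this

end Literature.NumberTheory.Transcendental.GaGm.Asymp

end

open MvPolynomial Module

namespace Literature.NumberTheory.Transcendental

namespace GaGm

variable {n : ℕ}

/-! ### Hilbert functions of the box filtration -/

section Hilb

variable (D₀ D₁ : ℕ)

/-- The box pieces are finite-dimensional. [folklore] -/
instance finite_Box (t : ℕ) : Module.Finite ℂ ↥(Box (n := n) D₀ D₁ t) :=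
  haveI : Finite ↥(boxSet (n := n) D₀ D₁ t) := Finite.of_equiv _ (boxSetEquiv D₀ D₁ t).symm
  Module.Finite.of_basis (basisRestrictSupport ℂ (boxSet (n := n) D₀ D₁ t))

/-- The Hilbert function of a subspace `N ⊆ ℂ[X, Y]` for the box filtration: the codimension of
`N ∩ Box(t)` in `Box(t)`. [folklore] -/
def hilbI (N : Submodule ℂ (MvPolynomial (Fin (n + 1)) ℂ)) (t : ℕ) : ℕ :=
  finrank ℂ ↥(Box (n := n) D₀ D₁ t) - finrank ℂ ↥(Box (n := n) D₀ D₁ t ⊓ N)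

/-- The Hilbert function of a subset `X ⊆ G(ℂ)`: that of its vanishing ideal,
`H_X(t) = dim Box(t) - dim (Box(t) ∩ 𝔍(X))` — the Hilbert function of the homogeneous ideal of the
closure of `X` in the Segre–Veronese embedding. [folklore] -/
def hilb (X : Set (GaGm n)) (t : ℕ) : ℕ :=
  hilbI (n := n) D₀ D₁ ((vanishing X).restrictScalars ℂ) t

variable {D₀ D₁}

/-- `dim(Box(t) ∩ N) ≤ dim Box(t)`. [folklore] -/
theorem finrank_inf_le (N : Submodule ℂ (MvPolynomial (Fin (n + 1)) ℂ)) (t : ℕ) :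
    finrank ℂ ↥(Box (n := n) D₀ D₁ t ⊓ N) ≤ finrank ℂ ↥(Box (n := n) D₀ D₁ t) :=
  Submodule.finrank_mono inf_le_left

/-- `H_N(t) + dim(Box(t) ∩ N) = dim Box(t)`. [folklore] -/
theorem hilbI_add_finrank_inf (N : Submodule ℂ (MvPolynomial (Fin (n + 1)) ℂ)) (t : ℕ) :
    hilbI (n := n) D₀ D₁ N t + finrank ℂ ↥(Box (n := n) D₀ D₁ t ⊓ N) = finrank ℂ ↥(Box (n := n) D₀ D₁ t) := by
  rw [hilbI, Nat.sub_add_cancel (finrank_inf_le N t)]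

/-- The Hilbert function is antitone in the subspace. [folklore] -/
theorem hilbI_antitone {N N' : Submodule ℂ (MvPolynomial (Fin (n + 1)) ℂ)} (h : N ≤ N') (t : ℕ) :
    hilbI (n := n) D₀ D₁ N' t ≤ hilbI D₀ D₁ N t := by
  have h1 := hilbI_add_finrank_inf (n := n) (D₀ := D₀) (D₁ := D₁) N t
  have h2 := hilbI_add_finrank_inf (n := n) (D₀ := D₀) (D₁ := D₁) N' t
  have h3 : finrank ℂ ↥(Box (n := n) D₀ D₁ t ⊓ N) ≤ finrank ℂ ↥(Box (n := n) D₀ D₁ t ⊓ N') :=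
    Submodule.finrank_mono (inf_le_inf_left _ h)
  omega

/-- `H_{(1)}(t) = 0`. [folklore] -/
theorem hilbI_top (t : ℕ) : hilbI (n := n) D₀ D₁ ⊤ t = 0 := by
  rw [hilbI, inf_top_eq, Nat.sub_self]

/-- The Hilbert function is monotone in `t`: `Box(t)/(Box(t) ∩ N) ↪ Box(t+1)/(Box(t+1) ∩ N)`.
[folklore] -/
theorem hilbI_mono (N : Submodule ℂ (MvPolynomial (Fin (n + 1)) ℂ)) {t t' : ℕ} (h : t ≤ t') :
    hilbI (n := n) D₀ D₁ N t ≤ hilbI D₀ D₁ N t' := by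
  have hB : Box (n := n) D₀ D₁ t ≤ Box D₀ D₁ t' := Box_mono h
  have hinf : Box (n := n) D₀ D₁ t ⊓ (Box D₀ D₁ t' ⊓ N) = Box D₀ D₁ t ⊓ N := by
    rw [← inf_assoc, inf_eq_left.mpr hB]
  have hsup : Box (n := n) D₀ D₁ t ⊔ (Box D₀ D₁ t' ⊓ N) ≤ Box D₀ D₁ t' := sup_le hB inf_le_left
  have h1 := Submodule.finrank_sup_add_finrank_inf_eq (Box (n := n) D₀ D₁ t) (Box D₀ D₁ t' ⊓ N)
  rw [hinf] at h1
  have h2 : finrank ℂ ↥(Box (n := n) D₀ D₁ t ⊔ (Box D₀ D₁ t' ⊓ N)) ≤ finrank ℂ ↥(Box (n := n) D₀ D₁ t') :=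
    Submodule.finrank_mono hsup
  have h3 := hilbI_add_finrank_inf (n := n) (D₀ := D₀) (D₁ := D₁) N t
  have h4 := hilbI_add_finrank_inf (n := n) (D₀ := D₀) (D₁ := D₁) N t'
  omega

/-! ### Multiplication by a non-zero-divisor modulo a prime -/

/-- Multiplication by `a ∈ Box(δ)` maps `Box(s)` into `Box(s + δ)`. [folklore] -/
theorem map_mulLeft_Box_le {δ s : ℕ} {a : MvPolynomial (Fin (n + 1)) ℂ} (ha : a ∈ Box (n := n) D₀ D₁ δ) :
    (Box (n := n) D₀ D₁ s).map (LinearMap.mulLeft ℂ a) ≤ Box D₀ D₁ (s + δ) := by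
  rintro _ ⟨v, hv, rfl⟩
  have h := mul_mem_Box ha hv
  have e : δ + s = s + δ := Nat.add_comm δ s
  rw [e] at h
  exact h

/-- For a prime `𝔮 ∌ a`: `(a·M) ∩ 𝔮 = a·(M ∩ 𝔮)`. [folklore] -/
theorem map_mulLeft_inf_prime {𝔮 : Ideal (MvPolynomial (Fin (n + 1)) ℂ)} (h𝔮 : 𝔮.IsPrime)
    {a : MvPolynomial (Fin (n + 1)) ℂ} (ha : a ∉ 𝔮) (M : Submodule ℂ (MvPolynomial (Fin (n + 1)) ℂ)) :
    M.map (LinearMap.mulLeft ℂ a) ⊓ 𝔮.restrictScalars ℂ = (M ⊓ 𝔮.restrictScalars ℂ).map (LinearMap.mulLeft ℂ a) := by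
  ext x
  simp only [Submodule.mem_inf, Submodule.mem_map, LinearMap.mulLeft_apply, Submodule.restrictScalars_mem]
  constructor
  · rintro ⟨⟨v, hv, rfl⟩, hx⟩
    exact ⟨v, ⟨hv, (h𝔮.mem_or_mem hx).resolve_left ha⟩, rfl⟩
  · rintro ⟨v, ⟨hv, hv𝔮⟩, rfl⟩
    exact ⟨⟨v, hv, rfl⟩, 𝔮.mul_mem_left a hv𝔮⟩

/-- Multiplication by a non-zero polynomial preserves dimensions of subspaces. [folklore] -/
theorem finrank_map_mulLeft {a : MvPolynomial (Fin (n + 1)) ℂ} (ha : a ≠ 0)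
    (M : Submodule ℂ (MvPolynomial (Fin (n + 1)) ℂ)) [Module.Finite ℂ M] :
    finrank ℂ ↥(M.map (LinearMap.mulLeft ℂ a)) = finrank ℂ ↥M := by
  have hinj : Function.Injective (LinearMap.mulLeft ℂ a) := fun x y hxy => mul_left_cancel₀ ha hxy
  exact (Submodule.equivMapOfInjective _ hinj M).finrank_eq.symm

/-- **The basic dimension identity.** For a prime `𝔮`, `a ∈ Box(δ) \ 𝔮` and `t ≥ δ`:
`dim(a·Box(t-δ) + Box(t) ∩ 𝔮) + dim(Box(t-δ) ∩ 𝔮) = dim Box(t-δ) + dim(Box(t) ∩ 𝔮)`. [folklore] -/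
theorem finrank_mulShift {𝔮 : Ideal (MvPolynomial (Fin (n + 1)) ℂ)} (h𝔮 : 𝔮.IsPrime)
    {a : MvPolynomial (Fin (n + 1)) ℂ} {δ : ℕ} (haB : a ∈ Box (n := n) D₀ D₁ δ) (ha : a ∉ 𝔮)
    {t : ℕ} (ht : δ ≤ t) :
    finrank ℂ ↥((Box (n := n) D₀ D₁ (t - δ)).map (LinearMap.mulLeft ℂ a) ⊔ (Box D₀ D₁ t ⊓ 𝔮.restrictScalars ℂ)) +
      finrank ℂ ↥(Box (n := n) D₀ D₁ (t - δ) ⊓ 𝔮.restrictScalars ℂ) =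
    finrank ℂ ↥(Box (n := n) D₀ D₁ (t - δ)) + finrank ℂ ↥(Box (n := n) D₀ D₁ t ⊓ 𝔮.restrictScalars ℂ) := by
  have ha0 : a ≠ 0 := fun h => ha (h ▸ 𝔮.zero_mem)
  have h1 := Submodule.finrank_sup_add_finrank_inf_eq
    ((Box (n := n) D₀ D₁ (t - δ)).map (LinearMap.mulLeft ℂ a)) (Box D₀ D₁ t ⊓ 𝔮.restrictScalars ℂ)
  have hle : (Box (n := n) D₀ D₁ (t - δ)).map (LinearMap.mulLeft ℂ a) ≤ Box D₀ D₁ t := by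
    have := map_mulLeft_Box_le (n := n) (s := t - δ) haB
    rwa [Nat.sub_add_cancel ht] at this
  have hinf : (Box (n := n) D₀ D₁ (t - δ)).map (LinearMap.mulLeft ℂ a) ⊓ (Box D₀ D₁ t ⊓ 𝔮.restrictScalars ℂ) =
      (Box (n := n) D₀ D₁ (t - δ) ⊓ 𝔮.restrictScalars ℂ).map (LinearMap.mulLeft ℂ a) := by
    rw [← inf_assoc, inf_eq_left.mpr hle, map_mulLeft_inf_prime h𝔮 ha]
  rw [hinf, finrank_map_mulLeft ha0, finrank_map_mulLeft ha0] at h1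
  omega

/-- **The section inequality.** For a prime `𝔭`, `ℓ ∈ Box(1) \ 𝔭` and `t ≥ 1`:
`H_{𝔭 + (ℓ)}(t) + H_𝔭(t - 1) ≤ H_𝔭(t)`. [folklore] -/
theorem hilbI_sup_span_add_le {𝔭 : Ideal (MvPolynomial (Fin (n + 1)) ℂ)} (h𝔭 : 𝔭.IsPrime)
    {ℓ : MvPolynomial (Fin (n + 1)) ℂ} (hℓB : ℓ ∈ Box (n := n) D₀ D₁ 1) (hℓ : ℓ ∉ 𝔭) {t : ℕ} (ht : 1 ≤ t) :
    hilbI (n := n) D₀ D₁ ((𝔭 ⊔ Ideal.span {ℓ}).restrictScalars ℂ) t + hilbI D₀ D₁ (𝔭.restrictScalars ℂ) (t - 1) ≤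
      hilbI D₀ D₁ (𝔭.restrictScalars ℂ) t := by
  have key := finrank_mulShift (D₀ := D₀) (D₁ := D₁) h𝔭 hℓB hℓ ht
  -- `a·Box(t-1) + Box(t) ∩ 𝔭 ⊆ Box(t) ∩ (𝔭 + (ℓ))`
  have hle : (Box (n := n) D₀ D₁ (t - 1)).map (LinearMap.mulLeft ℂ ℓ) ⊔ (Box D₀ D₁ t ⊓ 𝔭.restrictScalars ℂ) ≤
      Box D₀ D₁ t ⊓ (𝔭 ⊔ Ideal.span {ℓ}).restrictScalars ℂ := by
    refine sup_le ?_ (inf_le_inf_left _ fun x hx => Ideal.mem_sup_left hx)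
    have h1 : (Box (n := n) D₀ D₁ (t - 1)).map (LinearMap.mulLeft ℂ ℓ) ≤ Box D₀ D₁ t := by
      have := map_mulLeft_Box_le (n := n) (s := t - 1) hℓB
      rwa [Nat.sub_add_cancel ht] at this
    refine le_inf h1 ?_
    rintro _ ⟨v, -, rfl⟩
    exact Ideal.mem_sup_right (Ideal.mem_span_singleton.mpr (dvd_mul_right ℓ v))
  have h2 := Submodule.finrank_mono hle
  have h3 := hilbI_add_finrank_inf (n := n) (D₀ := D₀) (D₁ := D₁) ((𝔭 ⊔ Ideal.span {ℓ}).restrictScalars ℂ) t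
  have h4 := hilbI_add_finrank_inf (n := n) (D₀ := D₀) (D₁ := D₁) (𝔭.restrictScalars ℂ) t
  have h5 := hilbI_add_finrank_inf (n := n) (D₀ := D₀) (D₁ := D₁) (𝔭.restrictScalars ℂ) (t - 1)
  omega

/-- **The additivity inequality.** For a subspace `N`, a prime `𝔮`, and `a ∈ Box(δ) ∩ N \ 𝔮`,
`t ≥ δ`: `H_{N ∩ 𝔮}(t) ≥ H_N(t) + H_𝔮(t - δ)`. [folklore] -/
theorem hilbI_add_le_hilbI_inf {N : Submodule ℂ (MvPolynomial (Fin (n + 1)) ℂ)}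
    {𝔮 : Ideal (MvPolynomial (Fin (n + 1)) ℂ)} (h𝔮 : 𝔮.IsPrime)
    {a : MvPolynomial (Fin (n + 1)) ℂ} {δ : ℕ} (haB : a ∈ Box (n := n) D₀ D₁ δ) (haN : a ∈ N)
    (hN : ∀ (x y : MvPolynomial (Fin (n + 1)) ℂ), y ∈ N → x * y ∈ N) (ha : a ∉ 𝔮) {t : ℕ} (ht : δ ≤ t) :
    hilbI (n := n) D₀ D₁ N t + hilbI D₀ D₁ (𝔮.restrictScalars ℂ) (t - δ) ≤
      hilbI D₀ D₁ (N ⊓ 𝔮.restrictScalars ℂ) t := by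
  have key := finrank_mulShift (D₀ := D₀) (D₁ := D₁) h𝔮 haB ha ht
  -- `dim(Box t ∩ N ∩ 𝔮) = dim(Box t ∩ N) + dim(Box t ∩ 𝔮) - dim((Box t ∩ N) + (Box t ∩ 𝔮))`
  have h1 := Submodule.finrank_sup_add_finrank_inf_eq (Box (n := n) D₀ D₁ t ⊓ N) (Box D₀ D₁ t ⊓ 𝔮.restrictScalars ℂ)
  have hinf : Box (n := n) D₀ D₁ t ⊓ N ⊓ (Box D₀ D₁ t ⊓ 𝔮.restrictScalars ℂ) =
      Box D₀ D₁ t ⊓ (N ⊓ 𝔮.restrictScalars ℂ) := by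
    rw [inf_inf_inf_comm, inf_idem]
  rw [hinf] at h1
  -- `a·Box(t-δ) + (Box t ∩ 𝔮) ⊆ (Box t ∩ N) + (Box t ∩ 𝔮)`
  have hle : (Box (n := n) D₀ D₁ (t - δ)).map (LinearMap.mulLeft ℂ a) ⊔ (Box D₀ D₁ t ⊓ 𝔮.restrictScalars ℂ) ≤
      (Box D₀ D₁ t ⊓ N) ⊔ (Box D₀ D₁ t ⊓ 𝔮.restrictScalars ℂ) := by
    refine sup_le_sup_right ?_ _
    have h1 : (Box (n := n) D₀ D₁ (t - δ)).map (LinearMap.mulLeft ℂ a) ≤ Box D₀ D₁ t := by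
      have := map_mulLeft_Box_le (n := n) (s := t - δ) haB
      rwa [Nat.sub_add_cancel ht] at this
    refine le_inf h1 ?_
    rintro _ ⟨v, -, rfl⟩
    rw [LinearMap.mulLeft_apply, mul_comm]
    exact hN v a haN
  have h2 := Submodule.finrank_mono hle
  have h3 := hilbI_add_finrank_inf (n := n) (D₀ := D₀) (D₁ := D₁) N t
  have h4 := hilbI_add_finrank_inf (n := n) (D₀ := D₀) (D₁ := D₁) (𝔮.restrictScalars ℂ) (t - δ)
  have h5 := hilbI_add_finrank_inf (n := n) (D₀ := D₀) (D₁ := D₁) (N ⊓ 𝔮.restrictScalars ℂ) t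
  have h6 := finrank_inf_le (n := n) (D₀ := D₀) (D₁ := D₁) (𝔮.restrictScalars ℂ) t
  omega

/-- **Telescoping.** If `J ⊇ 𝔭` and `H_J(s) + H_𝔭(s-1) ≤ H_𝔭(s)` for `1 ≤ s`, then
`∑_{s ≤ t} H_J(s) ≤ H_𝔭(t)`. [folklore] -/
theorem sum_hilbI_le {J P : Submodule ℂ (MvPolynomial (Fin (n + 1)) ℂ)} (hJP : P ≤ J)
    (h : ∀ s, 1 ≤ s → hilbI (n := n) D₀ D₁ J s + hilbI D₀ D₁ P (s - 1) ≤ hilbI D₀ D₁ P s) (t : ℕ) :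
    ∑ s ∈ Finset.range (t + 1), hilbI (n := n) D₀ D₁ J s ≤ hilbI D₀ D₁ P t := by
  induction t with
  | zero => simpa using hilbI_antitone (n := n) (D₀ := D₀) (D₁ := D₁) hJP 0
  | succ t ih =>
    rw [Finset.sum_range_succ]
    have := h (t + 1) (by omega)
    simp only [Nat.add_sub_cancel] at this
    omega

/-! ### The bridge to `FilteredHilbert.hilbert_sandwich` -/

/-- `H_X(t) = dim` of the image of `Box(t)` in `ℂ[X, Y] ⧸ 𝔍(X)`. [folklore] -/
theorem hilb_eq_finrank_map (X : Set (GaGm n)) (t : ℕ) :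
    hilb D₀ D₁ X t = finrank ℂ ↥((Box (n := n) D₀ D₁ t).map
      (Ideal.Quotient.mkₐ ℂ (vanishing X)).toLinearMap) := by
  set f := (Ideal.Quotient.mkₐ ℂ (vanishing X)).toLinearMap.domRestrict (Box (n := n) D₀ D₁ t) with hf
  have h1 := LinearMap.finrank_range_add_finrank_ker f
  rw [hf, LinearMap.range_domRestrict, LinearMap.ker_domRestrict] at h1
  have hker : LinearMap.ker (Ideal.Quotient.mkₐ ℂ (vanishing X)).toLinearMap =
      (vanishing X).restrictScalars ℂ := by
    ext x
    simp [Ideal.Quotient.eq_zero_iff_mem]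
  rw [hker] at h1
  have hcomap : finrank ℂ ↥(Submodule.comap (Box (n := n) D₀ D₁ t).subtype ((vanishing X).restrictScalars ℂ)) =
      finrank ℂ ↥(Box (n := n) D₀ D₁ t ⊓ (vanishing X).restrictScalars ℂ) := by
    have e : Submodule.comap (Box (n := n) D₀ D₁ t).subtype ((vanishing X).restrictScalars ℂ) =
        Submodule.comap (Box (n := n) D₀ D₁ t).subtype (Box D₀ D₁ t ⊓ (vanishing X).restrictScalars ℂ) := by
      rw [Submodule.comap_inf, Submodule.comap_subtype_self, top_inf_eq]
    rw [e]
    exact (Submodule.comapSubtypeEquivOfLe inf_le_left).finrank_eq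
  rw [hcomap] at h1
  have h2 := hilbI_add_finrank_inf (n := n) (D₀ := D₀) (D₁ := D₁) ((vanishing X).restrictScalars ℂ) t
  rw [hilb]
  omega

/-- `H_X(t) = dim_ℂ W^t` for `W` the image of `Box(1)` in `ℂ[X, Y] ⧸ 𝔍(X)` (the box filtration is
generated in degree one). [folklore] -/
theorem hilb_eq_finrank_pow (X : Set (GaGm n)) (t : ℕ) :
    hilb D₀ D₁ X t = finrank ℂ ↥(((Box (n := n) D₀ D₁ 1).map
      (Ideal.Quotient.mkₐ ℂ (vanishing X)).toLinearMap) ^ t) := by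
  rw [hilb_eq_finrank_map, ← Box_one_pow, Submodule.map_pow]

/-- **The sandwich for an irreducible closed subset of `G(ℂ)`**: `H_C(t)` is squeezed between
`ρ·binom(t - a + m, m)` and `ρ·binom(t + γ + m, m)`, `m = dim C`, `ρ ≥ 1`
(`FilteredHilbert.hilbert_sandwich` for the affine domain `ℂ[X, Y] ⧸ 𝔍(C)` and the image of
`Box(1)`). [folklore] -/
theorem IsIrred.exists_sandwich (hD₀ : 1 ≤ D₀) (hD₁ : 1 ≤ D₁) {C : Set (GaGm n)} (hC : IsIrred C) :
    ∃ ρ a γ : ℕ, 1 ≤ ρ ∧ ∀ t, a ≤ t →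
      ρ * (t - a + dimG C).choose (dimG C) ≤ hilb D₀ D₁ C t ∧
      hilb D₀ D₁ C t ≤ ρ * (t + γ + dimG C).choose (dimG C) := by
  haveI := hC.isPrime
  haveI : IsDomain (MvPolynomial (Fin (n + 1)) ℂ ⧸ vanishing C) := Ideal.Quotient.isDomain _
  set mk := Ideal.Quotient.mkₐ ℂ (vanishing C) with hmk
  set W : Submodule ℂ (MvPolynomial (Fin (n + 1)) ℂ ⧸ vanishing C) := (Box (n := n) D₀ D₁ 1).map mk.toLinearMap
    with hW
  have h1 : (1 : MvPolynomial (Fin (n + 1)) ℂ ⧸ vanishing C) ∈ W :=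
    ⟨1, one_mem_Box D₀ D₁ 1, map_one mk⟩
  have hgen : Algebra.adjoin ℂ (W : Set (MvPolynomial (Fin (n + 1)) ℂ ⧸ vanishing C)) = ⊤ := by
    rw [hW, Submodule.map_coe, AlgHom.coe_toLinearMap, Algebra.adjoin_image, adjoin_Box_one hD₀ hD₁,
      Algebra.map_top, AlgHom.range_eq_top]
    exact Ideal.Quotient.mkₐ_surjective ℂ _
  have hm : ringKrullDim (MvPolynomial (Fin (n + 1)) ℂ ⧸ vanishing C) = dimG C := (dimG_eq hC.nonempty).symm
  obtain ⟨ρ, a, γ, hρ, h⟩ :=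
    Literature.RingTheory.HilbertSamuel.FilteredHilbert.hilbert_sandwich (K := ℂ) W h1 hgen hm
  refine ⟨ρ, a, γ, hρ, fun t ht => ?_⟩
  rw [hilb_eq_finrank_pow]
  exact h t ht

/-! ### Multiplicity (degree) of an irreducible closed set -/

/-- `C` has multiplicity `ρ`: its Hilbert function is squeezed between `ρ·binom(t - a + m, m)` and
`ρ·binom(t + γ + m, m)`, `m = dim C` — i.e. `H_C(t) = ρ t^m/m! + O(t^{m-1})` with the
normalised leading coefficient `ρ = 𝓗(C)` of LNM 1752, Ch. 11, §2.2 (85). [folklore] -/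
def HasMult (D₀ D₁ : ℕ) (C : Set (GaGm n)) (ρ : ℕ) : Prop :=
  ∃ a γ : ℕ, ∀ t, a ≤ t →
    ρ * (t - a + dimG C).choose (dimG C) ≤ hilb D₀ D₁ C t ∧
    hilb D₀ D₁ C t ≤ ρ * (t + γ + dimG C).choose (dimG C)

open Filter Topology in
/-- The normalised Hilbert function converges to the multiplicity. [folklore] -/
theorem HasMult.tendsto {C : Set (GaGm n)} {ρ : ℕ} (h : HasMult D₀ D₁ C ρ) :
    Tendsto (fun t : ℕ => (((dimG C).factorial * hilb D₀ D₁ C t : ℕ) : ℝ) / (t : ℝ) ^ (dimG C))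
      atTop (𝓝 (ρ : ℝ)) := by
  obtain ⟨a, γ, hb⟩ := h
  set m := dimG C with hm
  have hlow := (Asymp.tendsto_factorial_mul_choose_div_pow m a m).const_mul (ρ : ℝ)
  have hhigh := (Asymp.tendsto_factorial_mul_choose_div_pow (γ + m) 0 m).const_mul (ρ : ℝ)
  rw [mul_one] at hlow hhigh
  refine tendsto_of_tendsto_of_tendsto_of_le_of_le' hlow hhigh ?_ ?_
  · filter_upwards [eventually_ge_atTop (a + 1)] with t ht
    have hpos : (0 : ℝ) < (t : ℝ) ^ m := by
      have : (0 : ℝ) < t := by exact_mod_cast (show 0 < t by omega)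
      positivity
    rw [← mul_div_assoc, div_le_div_iff_of_pos_right hpos]
    have h1 := (hb t (by omega)).1
    rw [show t + m - a = t - a + m by omega]
    have : (ρ : ℝ) * ((m.factorial * (t - a + m).choose m : ℕ) : ℝ) =
        ((m.factorial * (ρ * (t - a + m).choose m) : ℕ) : ℝ) := by push_cast; ring
    rw [this]
    exact_mod_cast Nat.mul_le_mul_left _ h1
  · filter_upwards [eventually_ge_atTop (a + 1)] with t ht
    have hpos : (0 : ℝ) < (t : ℝ) ^ m := by
      have : (0 : ℝ) < t := by exact_mod_cast (show 0 < t by omega)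
      positivity
    rw [← mul_div_assoc, div_le_div_iff_of_pos_right hpos]
    have h1 := (hb t (by omega)).2
    rw [Nat.sub_zero, show t + (γ + m) = t + γ + m by omega]
    have : (ρ : ℝ) * ((m.factorial * (t + γ + m).choose m : ℕ) : ℝ) =
        ((m.factorial * (ρ * (t + γ + m).choose m) : ℕ) : ℝ) := by push_cast; ring
    rw [this]
    exact_mod_cast Nat.mul_le_mul_left _ h1

/-- The multiplicity is unique. [folklore] -/
theorem HasMult.unique {C : Set (GaGm n)} {ρ ρ' : ℕ} (h : HasMult D₀ D₁ C ρ) (h' : HasMult D₀ D₁ C ρ') :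
    ρ = ρ' := by
  have := tendsto_nhds_unique h.tendsto h'.tendsto
  exact_mod_cast this

open Classical in
/-- The multiplicity (degree) `𝓗(C)` of a subset of `G(ℂ)` for the box degrees `(D₀, D₁)` (junk
value `0` when no multiplicity exists, e.g. for reducible sets). [folklore] -/
def mult (D₀ D₁ : ℕ) (C : Set (GaGm n)) : ℕ :=
  if h : ∃ ρ, HasMult (n := n) D₀ D₁ C ρ then Classical.choose h else 0

/-- `mult` is the multiplicity. [folklore] -/
theorem HasMult.mult_eq {C : Set (GaGm n)} {ρ : ℕ} (h : HasMult D₀ D₁ C ρ) : mult D₀ D₁ C = ρ := by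
  have hex : ∃ ρ, HasMult (n := n) D₀ D₁ C ρ := ⟨ρ, h⟩
  rw [mult, dif_pos hex]
  exact (Classical.choose_spec hex).unique h

/-- Irreducible closed sets have a multiplicity, and it is `≥ 1`. [folklore] -/
theorem IsIrred.hasMult (hD₀ : 1 ≤ D₀) (hD₁ : 1 ≤ D₁) {C : Set (GaGm n)} (hC : IsIrred C) :
    HasMult D₀ D₁ C (mult D₀ D₁ C) ∧ 1 ≤ mult D₀ D₁ C := by
  obtain ⟨ρ, a, γ, hρ, h⟩ := hC.exists_sandwich (D₀ := D₀) (D₁ := D₁) hD₀ hD₁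
  have hm : HasMult D₀ D₁ C ρ := ⟨a, γ, h⟩
  rw [hm.mult_eq]
  exact ⟨hm, hρ⟩

/-! ### The multiplicity of `G` is `(n+1)! D₀ D₁ⁿ` -/

/-- `H_G(t) = (tD₀+1)(tD₁+1)ⁿ`. [folklore] -/
theorem hilb_univ (t : ℕ) : hilb D₀ D₁ (Set.univ : Set (GaGm n)) t = (t * D₀ + 1) * (t * D₁ + 1) ^ n := by
  rw [hilb, hilbI, vanishing_univ, finrank_Box]
  have : Box (n := n) D₀ D₁ t ⊓ (⊥ : Ideal (MvPolynomial (Fin (n + 1)) ℂ)).restrictScalars ℂ = ⊥ := by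
    rw [Submodule.restrictScalars_bot, inf_bot_eq]
  rw [this, finrank_bot, Nat.sub_zero]

/-- **`𝓗(G; D₀, D₁) = (n+1)! D₀ D₁ⁿ`**: the normalised leading coefficient of
`(tD₀ + 1)(tD₁ + 1)ⁿ`. [folklore] -/
theorem hasMult_univ (hD₀ : 1 ≤ D₀) (hD₁ : 1 ≤ D₁) :
    HasMult D₀ D₁ (Set.univ : Set (GaGm n)) ((n + 1).factorial * D₀ * D₁ ^ n) := by
  refine ⟨n + 1, 0, fun t ht => ?_⟩
  rw [dimG_univ, hilb_univ]
  constructor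
  · -- `(n+1)! C(t, n+1) D₀ D₁ⁿ = t(t-1)⋯(t-n) D₀D₁ⁿ ≤ t^{n+1} D₀ D₁ⁿ ≤ (tD₀+1)(tD₁+1)ⁿ`
    rw [show t - (n + 1) + (n + 1) = t by omega]
    have h1 : (n + 1).factorial * t.choose (n + 1) ≤ t ^ (n + 1) := by
      rw [← Nat.descFactorial_eq_factorial_mul_choose]; exact Nat.descFactorial_le_pow _ _
    calc (n + 1).factorial * D₀ * D₁ ^ n * t.choose (n + 1)
        = ((n + 1).factorial * t.choose (n + 1)) * (D₀ * D₁ ^ n) := by ring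
      _ ≤ t ^ (n + 1) * (D₀ * D₁ ^ n) := Nat.mul_le_mul_right _ h1
      _ = (t * D₀) * (t * D₁) ^ n := by ring
      _ ≤ (t * D₀ + 1) * (t * D₁ + 1) ^ n :=
          Nat.mul_le_mul (Nat.le_succ _) (Nat.pow_le_pow_left (Nat.le_succ _) _)
  · -- `(tD₀+1)(tD₁+1)ⁿ ≤ D₀D₁ⁿ (t+1)^{n+1} ≤ D₀ D₁ⁿ (t+1)(t+2)⋯(t+n+1)`
    rw [Nat.add_zero]
    have h1 : (t + 1) ^ (n + 1) ≤ (n + 1).factorial * (t + (n + 1)).choose (n + 1) := by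
      rw [← Nat.descFactorial_eq_factorial_mul_choose]
      have := Nat.pow_sub_le_descFactorial (t + (n + 1)) (n + 1)
      rwa [show t + (n + 1) + 1 - (n + 1) = t + 1 by omega] at this
    calc (t * D₀ + 1) * (t * D₁ + 1) ^ n
        ≤ ((t + 1) * D₀) * ((t + 1) * D₁) ^ n := by
          refine Nat.mul_le_mul (by nlinarith) (Nat.pow_le_pow_left (by nlinarith) _)
      _ = (t + 1) ^ (n + 1) * (D₀ * D₁ ^ n) := by rw [mul_pow]; ring
      _ ≤ ((n + 1).factorial * (t + (n + 1)).choose (n + 1)) * (D₀ * D₁ ^ n) := Nat.mul_le_mul_right _ h1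
      _ = (n + 1).factorial * D₀ * D₁ ^ n * (t + (n + 1)).choose (n + 1) := by ring

/-- `𝓗(G; D₀, D₁) = (n+1)! D₀ D₁ⁿ`. [folklore] -/
theorem mult_univ (hD₀ : 1 ≤ D₀) (hD₁ : 1 ≤ D₁) :
    mult D₀ D₁ (Set.univ : Set (GaGm n)) = (n + 1).factorial * D₀ * D₁ ^ n :=
  (hasMult_univ hD₀ hD₁).mult_eq

/-! ### Translation invariance -/

open Pointwise in
/-- Hilbert functions are translation invariant. [folklore] -/
theorem hilb_smul (a : GaGm n) (X : Set (GaGm n)) (t : ℕ) : hilb D₀ D₁ (a • X) t = hilb D₀ D₁ X t := by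
  rw [hilb, hilb, hilbI, hilbI, vanishing_smul]
  congr 1
  -- `shift a` maps `Box t ∩ comap (shift a) 𝔍(X)` isomorphically onto `Box t ∩ 𝔍(X)`
  set f : MvPolynomial (Fin (n + 1)) ℂ →ₗ[ℂ] MvPolynomial (Fin (n + 1)) ℂ := (shift a).toLinearMap with hf
  have hinj : Function.Injective f := (shiftEquiv a).injective
  have hmap : (Box (n := n) D₀ D₁ t ⊓ ((vanishing X).comap (shift a)).restrictScalars ℂ).map f =
      Box D₀ D₁ t ⊓ (vanishing X).restrictScalars ℂ := by
    ext P
    simp only [Submodule.mem_map, Submodule.mem_inf, Submodule.restrictScalars_mem, Ideal.mem_comap]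
    constructor
    · rintro ⟨Q, ⟨hQB, hQ⟩, rfl⟩
      exact ⟨shift_mem_Box a hQB, hQ⟩
    · rintro ⟨hPB, hP⟩
      refine ⟨shift a⁻¹ P, ⟨shift_mem_Box a⁻¹ hPB, ?_⟩, ?_⟩
      · rwa [← AlgHom.comp_apply, ← shift_mul, inv_mul_cancel, shift_one]
      · change shift a (shift a⁻¹ P) = P
        rw [← AlgHom.comp_apply, ← shift_mul, inv_mul_cancel, shift_one]; rfl
  rw [← hmap]
  exact (Submodule.equivMapOfInjective f hinj _).finrank_eq

open Pointwise in
/-- Multiplicity data are translation invariant. [folklore] -/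
theorem HasMult.smul {C : Set (GaGm n)} {ρ : ℕ} (h : HasMult D₀ D₁ C ρ) (a : GaGm n) :
    HasMult D₀ D₁ (a • C) ρ := by
  obtain ⟨b, γ, hb⟩ := h
  refine ⟨b, γ, fun t ht => ?_⟩
  rw [dimG_smul, hilb_smul]
  exact hb t ht

open Pointwise in
/-- **Multiplicities are translation invariant.** [folklore] -/
theorem mult_smul (hD₀ : 1 ≤ D₀) (hD₁ : 1 ≤ D₁) {C : Set (GaGm n)} (hC : IsIrred C) (a : GaGm n) :
    mult D₀ D₁ (a • C) = mult D₀ D₁ C :=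
  ((hC.hasMult hD₀ hD₁).1.smul a).mult_eq

/-! ### Every polynomial lies in some box -/

/-- `P ∈ Box(deg P)` when `D₀, D₁ ≥ 1`. [folklore] -/
theorem mem_Box_totalDegree (hD₀ : 1 ≤ D₀) (hD₁ : 1 ≤ D₁) (P : MvPolynomial (Fin (n + 1)) ℂ) :
    P ∈ Box (n := n) D₀ D₁ P.totalDegree := by
  rw [mem_Box_iff]
  refine ⟨(degreeOf_le_totalDegree P 0).trans ?_, fun h => (degreeOf_le_totalDegree P _).trans ?_⟩
  · exact Nat.le_mul_of_pos_right _ hD₀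
  · exact Nat.le_mul_of_pos_right _ hD₁

/-! ### Additivity over pairwise incomparable primes -/

/-- **Additivity (lower bound).** For a finite set `S` of pairwise incomparable primes there is a
shift `δ` with `∑_{𝔮 ∈ S} H_𝔮(s - δ) ≤ H_{⋂ S}(s)` for all `s ≥ δ`. [folklore] -/
theorem exists_sum_hilbI_le_hilbI_inf (hD₀ : 1 ≤ D₀) (hD₁ : 1 ≤ D₁)
    (S : Finset (Ideal (MvPolynomial (Fin (n + 1)) ℂ))) (hS : ∀ 𝔮 ∈ S, 𝔮.IsPrime)
    (hinc : ∀ 𝔮 ∈ S, ∀ 𝔮' ∈ S, 𝔮 ≤ 𝔮' → 𝔮 = 𝔮') :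
    ∃ δ : ℕ, ∀ s, δ ≤ s →
      ∑ 𝔮 ∈ S, hilbI (n := n) D₀ D₁ (𝔮.restrictScalars ℂ) (s - δ) ≤
        hilbI D₀ D₁ ((S.inf id).restrictScalars ℂ) s := by
  classical
  induction S using Finset.induction_on with
  | empty => exact ⟨0, fun s _ => by simp⟩
  | insert 𝔮₀ S h𝔮₀ ih =>
    obtain ⟨δ, hδ⟩ := ih (fun 𝔮 h𝔮 => hS 𝔮 (Finset.mem_insert_of_mem h𝔮))
      (fun 𝔮 h𝔮 𝔮' h𝔮' => hinc 𝔮 (Finset.mem_insert_of_mem h𝔮) 𝔮' (Finset.mem_insert_of_mem h𝔮'))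
    have h𝔮₀p : 𝔮₀.IsPrime := hS 𝔮₀ (Finset.mem_insert_self _ _)
    -- an element of `⋂ S` outside `𝔮₀`
    have hnot : ¬ (S.inf id ≤ 𝔮₀) := by
      rw [h𝔮₀p.inf_le']
      rintro ⟨𝔮, h𝔮, hle⟩
      have := hinc 𝔮 (Finset.mem_insert_of_mem h𝔮) 𝔮₀ (Finset.mem_insert_self _ _) hle
      exact h𝔮₀ (this ▸ h𝔮)
    obtain ⟨a, haI, ha𝔮₀⟩ := Set.not_subset.mp hnot
    set δ' := a.totalDegree with hδ'
    have haB : a ∈ Box (n := n) D₀ D₁ δ' := mem_Box_totalDegree hD₀ hD₁ a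
    refine ⟨δ + δ', fun s hs => ?_⟩
    rw [Finset.sum_insert h𝔮₀, Finset.inf_insert, id]
    have key := hilbI_add_le_hilbI_inf (D₀ := D₀) (D₁ := D₁) (N := (S.inf id).restrictScalars ℂ) h𝔮₀p haB haI
      (fun x y hy => Ideal.mul_mem_left _ x hy) ha𝔮₀ (t := s) (by omega)
    have hrs : (S.inf id).restrictScalars ℂ ⊓ 𝔮₀.restrictScalars ℂ =
        (𝔮₀ ⊓ S.inf id).restrictScalars ℂ := by
      rw [inf_comm, Submodule.restrictScalars_inf]
    rw [hrs] at key
    have h1 := hδ s (by omega)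
    have h2 : ∑ 𝔮 ∈ S, hilbI (n := n) D₀ D₁ (𝔮.restrictScalars ℂ) (s - (δ + δ')) ≤
        ∑ 𝔮 ∈ S, hilbI (n := n) D₀ D₁ (𝔮.restrictScalars ℂ) (s - δ) :=
      Finset.sum_le_sum fun 𝔮 _ => hilbI_mono _ (by omega)
    have h3 : hilbI (n := n) D₀ D₁ (𝔮₀.restrictScalars ℂ) (s - (δ + δ')) ≤
        hilbI D₀ D₁ (𝔮₀.restrictScalars ℂ) (s - δ') := hilbI_mono _ (by omega)
    omega

/-! ### Sums of Hilbert functions of an irreducible set -/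

/-- Lower bound for the partial sums of `H_{C'}` from the sandwich (hockey stick). [folklore] -/
theorem mul_choose_le_sum_hilb {C' : Set (GaGm n)} {ρ' a' γ' : ℕ}
    (h : ∀ t, a' ≤ t → ρ' * (t - a' + dimG C').choose (dimG C') ≤ hilb D₀ D₁ C' t ∧
      hilb D₀ D₁ C' t ≤ ρ' * (t + γ' + dimG C').choose (dimG C')) {N : ℕ} (hN : a' ≤ N) :
    ρ' * (N - a' + dimG C' + 1).choose (dimG C' + 1) ≤ ∑ s ∈ Finset.range (N + 1), hilb D₀ D₁ C' s := by
  set m' := dimG C' with hm'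
  have hsub : ∑ i ∈ Finset.range (N - a' + 1), hilb D₀ D₁ C' (i + a') ≤ ∑ s ∈ Finset.range (N + 1), hilb D₀ D₁ C' s := by
    have e : ∑ i ∈ Finset.range (N - a' + 1), hilb D₀ D₁ C' (i + a') =
        ∑ s ∈ (Finset.range (N - a' + 1)).map (addRightEmbedding a'), hilb D₀ D₁ C' s := by
      rw [Finset.sum_map]; rfl
    rw [e]
    refine Finset.sum_le_sum_of_subset_of_nonneg ?_ (fun _ _ _ => Nat.zero_le _)
    intro x hx
    simp only [Finset.mem_map, Finset.mem_range, addRightEmbedding_apply] at hx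
    obtain ⟨i, hi, rfl⟩ := hx
    rw [Finset.mem_range]; omega
  refine le_trans ?_ hsub
  rw [← Nat.sum_range_add_choose, Finset.mul_sum]
  refine Finset.sum_le_sum fun i hi => ?_
  have := (h (i + a') (by omega)).1
  rwa [show i + a' - a' + m' = i + m' by omega] at this

/-! ### The section inequality for multiplicities -/

/-- **Bézout for a hypersurface section (set-theoretic, inequality).** For an irreducible closed
`C ⊆ G(ℂ)` and a box polynomial `ℓ ∈ Box(1)` not vanishing identically on `C`, the multiplicities
of the components of `C ∩ Z(ℓ)` add up to at most the multiplicity of `C`: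
`∑_{C'} 𝓗(C') ≤ 𝓗(C)`. (LNM 1752, Ch. 11, §2.2 (iii) "Bézout's Lemma", read through the
Nullstellensatz; the proof is `H_{𝔍(C)+(ℓ)}(s) ≤ H_C(s) - H_C(s-1)`, additivity of Hilbert
functions over the components up to lower order, summation over `s ≤ t` and comparison of leading
coefficients.) [folklore] -/
theorem sum_mult_section_le (hD₀ : 1 ≤ D₀) (hD₁ : 1 ≤ D₁) {C : Set (GaGm n)} (hC : IsIrred C)
    {ℓ : MvPolynomial (Fin (n + 1)) ℂ} (hℓB : ℓ ∈ Box (n := n) D₀ D₁ 1) (hℓ : ℓ ∉ vanishing C) :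
    ∑ 𝔮 ∈ (Ideal.finite_minimalPrimes_of_isNoetherianRing _ (vanishing (C ∩ zeroSet {ℓ}))).toFinset,
      mult D₀ D₁ (zeroSet (n := n) (𝔮 : Set (MvPolynomial (Fin (n + 1)) ℂ))) ≤ mult D₀ D₁ C := by
  classical
  set S := (Ideal.finite_minimalPrimes_of_isNoetherianRing _ (vanishing (C ∩ zeroSet {ℓ}))).toFinset with hSdef
  have hSmem : ∀ 𝔮, 𝔮 ∈ S ↔ 𝔮 ∈ (vanishing (C ∩ zeroSet {ℓ})).minimalPrimes := fun 𝔮 => by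
    rw [hSdef, Set.Finite.mem_toFinset]
  haveI := hC.isPrime
  set m := dimG C with hm
  -- data of the components
  have hcomp : ∀ 𝔮 ∈ S, IsIrred (zeroSet (n := n) ↑𝔮) ∧ vanishing (zeroSet (n := n) ↑𝔮) = 𝔮 ∧
      dimG (zeroSet (n := n) ↑𝔮) + 1 = m := by
    intro 𝔮 h𝔮
    rw [hSmem] at h𝔮
    obtain ⟨h1, h2, -⟩ := isIrred_zeroSet_of_mem_minimalPrimes h𝔮
    exact ⟨h1, h2, dimG_add_one_of_mem_minimalPrimes_section hC hℓ h𝔮⟩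
  -- the empty case (e.g. `dim C = 0`)
  by_cases hSne : S = ∅
  · rw [hSne, Finset.sum_empty]; exact Nat.zero_le _
  have hm1 : 1 ≤ m := by
    obtain ⟨𝔮, h𝔮⟩ := Finset.nonempty_iff_ne_empty.mpr hSne
    have := (hcomp 𝔮 h𝔮).2.2; omega
  -- sandwich data for `C` and for the components
  obtain ⟨⟨a, γ, hCb⟩, hρ⟩ := hC.hasMult (D₀ := D₀) (D₁ := D₁) hD₀ hD₁
  have hq : ∀ 𝔮 ∈ S, ∃ aγ : ℕ × ℕ, ∀ t, aγ.1 ≤ t →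
      mult D₀ D₁ (zeroSet (n := n) ↑𝔮) * (t - aγ.1 + dimG (zeroSet (n := n) ↑𝔮)).choose (dimG (zeroSet (n := n) ↑𝔮)) ≤
        hilb D₀ D₁ (zeroSet (n := n) ↑𝔮) t ∧
      hilb D₀ D₁ (zeroSet (n := n) ↑𝔮) t ≤
        mult D₀ D₁ (zeroSet (n := n) ↑𝔮) * (t + aγ.2 + dimG (zeroSet (n := n) ↑𝔮)).choose (dimG (zeroSet (n := n) ↑𝔮)) := by
    intro 𝔮 h𝔮
    obtain ⟨⟨a', γ', hb⟩, -⟩ := (hcomp 𝔮 h𝔮).1.hasMult (D₀ := D₀) (D₁ := D₁) hD₀ hD₁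
    exact ⟨(a', γ'), hb⟩
  choose! aγ haγ using hq
  -- additivity
  obtain ⟨δ, hδ⟩ := exists_sum_hilbI_le_hilbI_inf (n := n) (D₀ := D₀) (D₁ := D₁) hD₀ hD₁ S
    (fun 𝔮 h𝔮 => ((hSmem 𝔮).mp h𝔮).isPrime)
    (fun 𝔮 h𝔮 𝔮' h𝔮' hle => by
      have h1 := (hcomp 𝔮 h𝔮).2.1
      have h2 := (hcomp 𝔮' h𝔮').2.1
      refine eq_of_zeroSet_subset_of_mem_minimalPrimes ((hSmem 𝔮').mp h𝔮') ((hSmem 𝔮).mp h𝔮) ?_ |>.symm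
      exact zeroSet_antitone hle)
  -- `J = 𝔍(C) + (ℓ)` and `K = 𝔍(C ∩ Z(ℓ)) = ⋂ S`
  set J : Submodule ℂ (MvPolynomial (Fin (n + 1)) ℂ) := (vanishing C ⊔ Ideal.span {ℓ}).restrictScalars ℂ with hJ
  have hKS : vanishing (C ∩ zeroSet {ℓ}) = S.inf id := by
    rw [Finset.inf_id_eq_sInf, hSdef, Set.Finite.coe_toFinset, Ideal.sInf_minimalPrimes,
      (vanishing_isRadical _).radical]
  have hJK : J ≤ (S.inf id).restrictScalars ℂ := by
    rw [← hKS, hJ, inter_zeroSet_singleton_eq hC.isClosedG]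
    exact fun P hP => subset_vanishing_zeroSet _ hP
  -- (1) telescoping: `∑_{s ≤ t} H_J(s) ≤ H_C(t)`
  have htel : ∀ t, ∑ s ∈ Finset.range (t + 1), hilbI (n := n) D₀ D₁ J s ≤ hilb D₀ D₁ C t := fun t =>
    sum_hilbI_le (fun P hP => Ideal.mem_sup_left hP)
      (fun s hs => hilbI_sup_span_add_le hC.isPrime hℓB hℓ hs) t
  -- (2) shifted sub-sums
  have hshift : ∀ (f : ℕ → ℕ) (t d : ℕ), d ≤ t →
      ∑ s ∈ Finset.range (t - d + 1), f (s + d) ≤ ∑ s ∈ Finset.range (t + 1), f s := by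
    intro f t d hd
    have e : ∑ s ∈ Finset.range (t - d + 1), f (s + d) =
        ∑ s ∈ (Finset.range (t - d + 1)).map (addRightEmbedding d), f s := by
      rw [Finset.sum_map]; rfl
    rw [e]
    refine Finset.sum_le_sum_of_subset_of_nonneg ?_ (fun _ _ _ => Nat.zero_le _)
    intro x hx
    simp only [Finset.mem_map, Finset.mem_range, addRightEmbedding_apply] at hx
    obtain ⟨i, hi, rfl⟩ := hx
    rw [Finset.mem_range]; omega
  -- (3) the main inequality for large `t`
  have hmain : ∀ t, δ + S.sup (fun 𝔮 => (aγ 𝔮).1) + a ≤ t →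
      ∑ 𝔮 ∈ S, mult D₀ D₁ (zeroSet (n := n) ↑𝔮) * (t - (δ + (aγ 𝔮).1) + m).choose m ≤
        mult D₀ D₁ C * (t + γ + m).choose m := by
    intro t ht
    have ha𝔮 : ∀ 𝔮 ∈ S, (aγ 𝔮).1 ≤ t - δ := fun 𝔮 h𝔮 => by
      have := Finset.le_sup (f := fun 𝔮 => (aγ 𝔮).1) h𝔮; omega
    refine le_trans ?_ (hCb t (by omega)).2
    refine le_trans ?_ (htel t)
    refine le_trans ?_ (hshift _ t δ (by omega))
    -- `∑_𝔮 ρ_𝔮 C(…) ≤ ∑_{s ≤ t - δ} ∑_𝔮 H_𝔮(s) ≤ ∑_{s ≤ t-δ} H_K(s + δ) ≤ ∑_{s ≤ t - δ} H_J(s + δ)`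
    have h1 : ∀ s ∈ Finset.range (t - δ + 1),
        ∑ 𝔮 ∈ S, hilb D₀ D₁ (zeroSet (n := n) ↑𝔮) s ≤ hilbI (n := n) D₀ D₁ J (s + δ) := by
      intro s _
      refine le_trans ?_ (hilbI_antitone hJK _)
      have h := hδ (s + δ) (by omega)
      rw [Nat.add_sub_cancel] at h
      refine le_trans (le_of_eq (Finset.sum_congr rfl fun 𝔮 h𝔮 => ?_)) h
      rw [hilb, (hcomp 𝔮 h𝔮).2.1]
    refine le_trans ?_ (Finset.sum_le_sum h1)
    rw [Finset.sum_comm]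
    refine Finset.sum_le_sum fun 𝔮 h𝔮 => ?_
    have h2 := mul_choose_le_sum_hilb (D₀ := D₀) (D₁ := D₁) (haγ 𝔮 h𝔮) (ha𝔮 𝔮 h𝔮)
    have hm' := (hcomp 𝔮 h𝔮).2.2
    rw [show t - δ - (aγ 𝔮).1 + dimG (zeroSet (n := n) ↑𝔮) + 1 = t - (δ + (aγ 𝔮).1) + m by omega,
      hm'] at h2
    exact h2
  exact Asymp.sum_le_of_choose_ineq S (mult D₀ D₁ C) (fun 𝔮 => mult D₀ D₁ (zeroSet (n := n) ↑𝔮))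
    (fun 𝔮 => δ + (aγ 𝔮).1) γ m _ hmain

/-! ### The components of a closed set, as a finite set of primes -/

/-- The (finite) set of minimal primes of `𝔍(X)`, indexing the irreducible components of the
closure of `X`. [folklore] -/
def comps (X : Set (GaGm n)) : Finset (Ideal (MvPolynomial (Fin (n + 1)) ℂ)) :=
  (Ideal.finite_minimalPrimes_of_isNoetherianRing _ (vanishing X)).toFinset

/-- Membership in `comps`. [folklore] -/
theorem mem_comps {X : Set (GaGm n)} {𝔮 : Ideal (MvPolynomial (Fin (n + 1)) ℂ)} :
    𝔮 ∈ comps X ↔ 𝔮 ∈ (vanishing X).minimalPrimes := by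
  rw [comps, Set.Finite.mem_toFinset]

/-- Sums over a union are bounded by the sum of the sums (non-negative terms). [folklore] -/
theorem sum_biUnion_le_sum {ι κ : Type*} [DecidableEq κ] (s : Finset ι) (B : ι → Finset κ) (f : κ → ℕ) :
    ∑ x ∈ s.biUnion B, f x ≤ ∑ i ∈ s, ∑ x ∈ B i, f x := by
  classical
  induction s using Finset.induction_on with
  | empty => simp
  | insert a s ha ih =>
    rw [Finset.biUnion_insert, Finset.sum_insert ha]
    have h := Finset.sum_union_inter (s₁ := B a) (s₂ := s.biUnion B) (f := f)
    have : ∑ x ∈ B a ∪ s.biUnion B, f x ≤ ∑ x ∈ B a, f x + ∑ x ∈ s.biUnion B, f x := by omega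
    exact this.trans (Nat.add_le_add_left ih _)

/-- Sums over a subset of a union are bounded by the sum of the sums. [folklore] -/
theorem sum_le_sum_biUnion {ι κ : Type*} [DecidableEq κ] (s : Finset ι) (B : ι → Finset κ)
    (A : Finset κ) (hA : A ⊆ s.biUnion B) (f : κ → ℕ) :
    ∑ x ∈ A, f x ≤ ∑ i ∈ s, ∑ x ∈ B i, f x :=
  le_trans (Finset.sum_le_sum_of_subset_of_nonneg hA fun _ _ _ => Nat.zero_le _) (sum_biUnion_le_sum s B f)

/-- The zero set of an ideal (abbreviation fixing the coercion). [folklore] -/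
abbrev zeroSetI (𝔮 : Ideal (MvPolynomial (Fin (n + 1)) ℂ)) : Set (GaGm n) :=
  zeroSet (n := n) (𝔮 : Set (MvPolynomial (Fin (n + 1)) ℂ))

/-! ### Bézout inequality in `G(ℂ)` for box polynomials (all top-dimensional components) -/

/-- The inductive form: for an irreducible closed `C` and `X = C ∩ Z(F)`, `F ⊆ Box(1)`, the
multiplicities of the components of `X` of dimension `dim X` add up to at most `𝓗(C)`.
[folklore] -/
theorem sum_mult_le_mult_aux (hD₀ : 1 ≤ D₀) (hD₁ : 1 ≤ D₁) {F : Set (MvPolynomial (Fin (n + 1)) ℂ)}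
    (hF : F ⊆ Box (n := n) D₀ D₁ 1) :
    ∀ (k : ℕ) (C : Set (GaGm n)), IsIrred C → (C ∩ zeroSet F).Nonempty →
      dimG C ≤ dimG (C ∩ zeroSet F) + k →
      ∑ 𝔮 ∈ (comps (C ∩ zeroSet F)).filter
          (fun 𝔮 => dimG (zeroSetI (n := n) 𝔮) = dimG (C ∩ zeroSet F)),
        mult D₀ D₁ (zeroSetI (n := n) 𝔮) ≤ mult D₀ D₁ C := by
  classical
  -- the case `dim X = dim C`: `X = C`
  have top_case : ∀ C : Set (GaGm n), IsIrred C → (C ∩ zeroSet F).Nonempty →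
      dimG (C ∩ zeroSet F) = dimG C →
      ∑ 𝔮 ∈ (comps (C ∩ zeroSet F)).filter
          (fun 𝔮 => dimG (zeroSetI (n := n) 𝔮) = dimG (C ∩ zeroSet F)),
        mult D₀ D₁ (zeroSetI (n := n) 𝔮) ≤ mult D₀ D₁ C := by
    intro C hC hne hd
    set X := C ∩ zeroSet F with hXdef
    have hXcl : IsClosedG X := hC.isClosedG.inter (isClosedG_zeroSet F)
    obtain ⟨𝔮₀, h𝔮₀, hd𝔮₀⟩ := exists_minimalPrimes_dimG_eq hne
    obtain ⟨hirr, hv, hsub⟩ := isIrred_zeroSet_of_mem_minimalPrimes h𝔮₀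
    rw [hXcl.eq] at hsub
    have hZC : zeroSet (n := n) ↑𝔮₀ = C :=
      hC.eq_of_subset_of_dimG_eq hirr.isClosedG hirr.nonempty (hsub.trans Set.inter_subset_left)
        (by rw [hd𝔮₀, hd])
    have hXC : X = C := Set.Subset.antisymm Set.inter_subset_left (hZC ▸ hsub)
    have hvX : vanishing X = vanishing C := by rw [hXC]
    haveI := hC.isPrime
    have hcomps : comps X = {vanishing C} := by
      ext 𝔮
      rw [mem_comps, hvX, Ideal.minimalPrimes_eq_subsingleton_self, Set.mem_singleton_iff,
        Finset.mem_singleton]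
    rw [hcomps, Finset.sum_filter, Finset.sum_singleton]
    simp only [zeroSetI, hC.isClosedG.eq]
    split_ifs <;> simp
  intro k
  induction k with
  | zero =>
    intro C hC hne hk
    have : dimG (C ∩ zeroSet F) = dimG C :=
      le_antisymm (dimG_mono Set.inter_subset_left) (by simpa using hk)
    exact top_case C hC hne this
  | succ k ih =>
    intro C hC hne hk
    set X := C ∩ zeroSet F with hXdef
    set m := dimG X with hm
    by_cases htop : dimG X = dimG C
    · exact top_case C hC hne htop
    have hlt : m < dimG C := lt_of_le_of_ne (dimG_mono Set.inter_subset_left) htop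
    -- a box polynomial of `F` not vanishing on `C`
    obtain ⟨ℓ, hℓF, hℓ⟩ : ∃ ℓ ∈ F, ℓ ∉ vanishing C := by
      by_contra! h
      apply htop
      have : C ⊆ zeroSet F := fun g hg P hP => h P hP g hg
      rw [hXdef, Set.inter_eq_left.mpr this]
    have hXcl : IsClosedG X := hC.isClosedG.inter (isClosedG_zeroSet F)
    -- the components `C'` of `C ∩ Z(ℓ)`
    set T := comps (C ∩ zeroSet {ℓ}) with hT
    have hT' : ∀ 𝔮' ∈ T, IsIrred (zeroSet (n := n) ↑𝔮') ∧ vanishing (zeroSet (n := n) ↑𝔮') = 𝔮' ∧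
        dimG (zeroSet (n := n) ↑𝔮') + 1 = dimG C := by
      intro 𝔮' h𝔮'
      rw [hT, mem_comps] at h𝔮'
      obtain ⟨h1, h2, -⟩ := isIrred_zeroSet_of_mem_minimalPrimes h𝔮'
      exact ⟨h1, h2, dimG_add_one_of_mem_minimalPrimes_section hC hℓ h𝔮'⟩
    have hXsub : X ⊆ ⋃ 𝔮' ∈ T, zeroSetI (n := n) 𝔮' := by
      have h1 : X ⊆ C ∩ zeroSet {ℓ} := fun g hg => ⟨hg.1, fun P hP => by
        rw [Set.mem_singleton_iff.mp hP]; exact hg.2 ℓ hℓF⟩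
      have h2 := (hC.isClosedG.inter (isClosedG_zeroSet {ℓ})).eq_biUnion_minimalPrimes
      rw [hT, comps]
      exact h1.trans h2.le
    -- the target components and where they go
    set A := (comps X).filter (fun 𝔮 => dimG (zeroSetI (n := n) 𝔮) = m)
      with hA
    let X' : Ideal (MvPolynomial (Fin (n + 1)) ℂ) → Set (GaGm n) := fun 𝔮' => zeroSet (n := n) ↑𝔮' ∩ zeroSet F
    set B : Ideal (MvPolynomial (Fin (n + 1)) ℂ) → Finset (Ideal (MvPolynomial (Fin (n + 1)) ℂ)) := fun 𝔮' =>
      (comps (X' 𝔮')).filter (fun 𝔮 => dimG (zeroSetI (n := n) 𝔮) = dimG (X' 𝔮'))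
      with hB
    set T' := T.filter (fun 𝔮' => dimG (X' 𝔮') = m) with hT'def
    have hAB : A ⊆ T'.biUnion B := by
      intro 𝔮 h𝔮
      rw [hA, Finset.mem_filter, mem_comps] at h𝔮
      obtain ⟨h𝔮, hd𝔮⟩ := h𝔮
      obtain ⟨hirr, hv𝔮, hsub⟩ := isIrred_zeroSet_of_mem_minimalPrimes h𝔮
      rw [hXcl.eq] at hsub
      -- `Z(𝔮)` lies in some `C'`
      obtain ⟨𝔮', h𝔮'T, hZ𝔮⟩ := hirr.exists_subset_of_subset_biUnion T _
        (fun 𝔮' h𝔮' => (hT' 𝔮' h𝔮').1.isClosedG) (hsub.trans hXsub)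
      have hZX' : zeroSet (n := n) ↑𝔮 ⊆ X' 𝔮' := fun g hg => ⟨hZ𝔮 hg, (hsub hg).2⟩
      have hX'X : X' 𝔮' ⊆ X := by
        intro g hg
        have h3 := (isIrred_zeroSet_of_mem_minimalPrimes ((mem_comps).mp h𝔮'T)).2.2 hg.1
        rw [(hC.isClosedG.inter (isClosedG_zeroSet {ℓ})).eq] at h3
        exact ⟨h3.1, hg.2⟩
      have hdX' : dimG (X' 𝔮') = m :=
        le_antisymm (dimG_mono hX'X) (hd𝔮 ▸ dimG_mono hZX')
      have hX'cl : IsClosedG (X' 𝔮') := (isClosedG_zeroSet _).inter (isClosedG_zeroSet F)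
      obtain ⟨𝔮₁, h𝔮₁, hZ𝔮₁⟩ := hirr.exists_eq_zeroSet_minimalPrimes hX'cl hZX' (by rw [hd𝔮, hdX'])
      have h𝔮𝔮₁ : 𝔮 = 𝔮₁ := by
        rw [← hv𝔮, hZ𝔮₁, (isIrred_zeroSet_of_mem_minimalPrimes h𝔮₁).2.1]
      rw [Finset.mem_biUnion]
      refine ⟨𝔮', ?_, ?_⟩
      · rw [hT'def, Finset.mem_filter]; exact ⟨h𝔮'T, hdX'⟩
      · rw [hB, Finset.mem_filter, mem_comps, hdX', h𝔮𝔮₁]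
        exact ⟨h𝔮₁, h𝔮𝔮₁ ▸ hd𝔮⟩
    -- assemble
    calc ∑ 𝔮 ∈ A, mult D₀ D₁ (zeroSet (n := n) ↑𝔮)
        ≤ ∑ 𝔮' ∈ T', ∑ 𝔮 ∈ B 𝔮', mult D₀ D₁ (zeroSet (n := n) ↑𝔮) := sum_le_sum_biUnion T' B A hAB _
      _ ≤ ∑ 𝔮' ∈ T', mult D₀ D₁ (zeroSet (n := n) ↑𝔮') := by
          refine Finset.sum_le_sum fun 𝔮' h𝔮' => ?_
          rw [hT'def, Finset.mem_filter] at h𝔮'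
          obtain ⟨h𝔮'T, hdX'⟩ := h𝔮'
          by_cases hne' : (X' 𝔮').Nonempty
          · have hCT := hT' 𝔮' h𝔮'T
            have hdim : dimG (zeroSetI (n := n) 𝔮') ≤ dimG (zeroSetI (n := n) 𝔮' ∩ zeroSet F) + k := by
              have h1 : dimG (zeroSetI (n := n) 𝔮') + 1 = dimG C := hCT.2.2
              have h2 : dimG (zeroSetI (n := n) 𝔮' ∩ zeroSet F) = m := hdX'
              have h3 : dimG C ≤ m + (k + 1) := hk
              omega
            exact ih (zeroSetI (n := n) 𝔮') hCT.1 hne' hdim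
          · rw [Set.not_nonempty_iff_eq_empty] at hne'
            have hB0 : B 𝔮' = ∅ := by
              rw [hB, Finset.filter_eq_empty_iff]
              intro 𝔮 h𝔮
              exfalso
              rw [mem_comps] at h𝔮
              have h := h𝔮.isPrime.ne_top
              apply h
              refine top_le_iff.mp (le_trans ?_ h𝔮.le)
              change ⊤ ≤ vanishing (X' 𝔮')
              rw [hne', vanishing_empty]
            rw [hB0, Finset.sum_empty]
            exact Nat.zero_le _
      _ ≤ ∑ 𝔮' ∈ T, mult D₀ D₁ (zeroSet (n := n) ↑𝔮') :=
          Finset.sum_le_sum_of_subset_of_nonneg (Finset.filter_subset _ _) fun _ _ _ => Nat.zero_le _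
      _ ≤ mult D₀ D₁ C := sum_mult_section_le hD₀ hD₁ hC (hF hℓF) hℓ

/-- **Bézout inequality in `G(ℂ) = ℂ × (ℂˣ)ⁿ` for box polynomials (Philippon's Prop. 3.3 /
LNM 1752 Ch. 11 Prop. 2.2 at `D = 1` in the Segre–Veronese embedding, set-theoretic form).** If
`F ⊆ Box(1)` has a common zero in `G(ℂ)`, the multiplicities of the irreducible components of
`Z(F)` of maximal dimension add up to at most `𝓗(G; D₀, D₁) = (n+1)! D₀ D₁ⁿ`:
`∑_{C top-dimensional component of Z(F)} 𝓗(C) ≤ (n+1)! D₀ D₁ⁿ`.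
[cite: NesterenkoPhilippon2001, Ch. 11 Prop. 2.2 (p. 202) with §2.2 (ii)] -/
theorem sum_mult_le_of_subset_Box (hD₀ : 1 ≤ D₀) (hD₁ : 1 ≤ D₁) {F : Set (MvPolynomial (Fin (n + 1)) ℂ)}
    (hF : F ⊆ Box (n := n) D₀ D₁ 1) (hne : (zeroSet (n := n) F).Nonempty) :
    ∑ 𝔮 ∈ (comps (zeroSet (n := n) F)).filter
        (fun 𝔮 => dimG (zeroSetI (n := n) 𝔮) = dimG (zeroSet (n := n) F)),
      mult D₀ D₁ (zeroSetI (n := n) 𝔮) ≤ (n + 1).factorial * D₀ * D₁ ^ n := by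
  have h := sum_mult_le_mult_aux (D₀ := D₀) (D₁ := D₁) hD₀ hD₁ hF (dimG (Set.univ : Set (GaGm n)))
    Set.univ isIrred_univ (by rwa [Set.univ_inter]) (by omega)
  rwa [Set.univ_inter, mult_univ hD₀ hD₁] at h

end Hilb

end GaGm

end Literature.NumberTheory.Transcendental
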